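import Summits.ResolutionOfSingularities.ResolutionOfSingularities.Theorems.HilbertSamuelEliminationSigmaMaxModificationsCorridor3WLadderBirthDefs
import Literature.AlgebraicGeometry.Resolution.PointBlowupMohStability
import Literature.AlgebraicGeometry.Resolution.PointBlowupFlagTranslatedStep
import Literature.AlgebraicGeometry.Hironaka2017.NearPointHilbertDomination
import Mathlib.Algebra.Module.LinearMap.Polynomial
import Mathlib.LinearAlgebra.Matrix.NonsingularInverse
import HarnessLib

/-!
# [OURS · L1 W4.2] ROUND-4 BIRTH LAW — the FORMS, part 1/2: `birthTidy : BirthTidy` (part 2/2 `…BirthFormsNear.lean`: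
# `birthNear : BirthNear`; split only because the gate caps Theorems files with proofs at 400 lines)
# (cell res-hironaka, LADDER-RESOLUTION rung L; slot W4.2, crux chain w42 `SigmaMaxModificationsCorridor3`
# stmt-ResolutionOfSingularities-19249; `--supports stmt-ResolutionOfSingularities-19249 --as helper`)

PROVENANCE. Companion of `…Corridor3WLadderBirthDefs.lean` (p505417: idea-1's §8 defs `VanishesToOrder`, `BirthTidy`,
`BirthNear`, from `L/res-L1-w42-idea-1/Sketch-L1-idea-1-C3.lean` sha16 `ea42ede6917f0ca2`), proving BOTH parameterless Props by
name, on res-L1-w42-plan-1's RULINGS v3.9-2 (I) / v3.9-3 (K) 2026-08-27 and res-plan-2's D→L MAP v1.15a. §A–§D (the exponent lemma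
and `birthTidy` via the `GL₃` frame change `Matrix.toMvPolynomial`) are res-type-067's kernel-closed handover
(`HOME/L/res-type-067/BirthLawScratch-067.lean` sha16 `2cfb71c046707e30`, STATUS 2026-08-27T06:16:26Z) landed unchanged by
res-D-pv-002 with thanks; §E (`birthNear` by the SHEAR reduction to the point `b = 0` of the exceptional divisor) is
res-D-pv-002's. Everything is OURS (elementary `MvPolynomial` algebra over a field; no scheme, no `Literature.…` NAMED FACT —
only the tree's proved point-blow-up chart / translation API of `Literature/AlgebraicGeometry/Resolution/PointBlowup*.lean`,
`WeightedBlowupNoIncrease.lean` and the linear-substitution lemmas of `Literature/AlgebraicGeometry/Hironaka2017/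
NearPointHilbertDomination.lean`; never a `Theses/…` import). NOT a statement of Hironaka's manuscript [Hironaka2017].
Consumer: idea-1's untidy-birth law for the W-top CORE `stub_Wtop3M_nonpointed` (K3d frontier). AI-written; no expert review;
AI review is weaker than expert review.

## What is proved

* §A `forall_homogeneousComponent_eq_zero_iff` — «all homogeneous components of degree `< μ` vanish» iff «all coefficients of
  degree `< μ` vanish» (the coefficient form of `VanishesToOrder`).
* §B the EXPONENT LEMMA `add_apply_le_of_lowOrder_translate_single`: a degree-`d` form `G` with `G(U + e_t)` of order `≥ μ` has
  `μ + s_t ≤ d` for every monomial `U^s` of `G` (the coefficient of `U^{s − s_t e_t}` in `G(U + e_t)` is `coeff s G`).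
* §C linear substitutions (`Matrix.toMvPolynomial`) versus translations: `(F ∘ M)(U + v) = (F(U + M v)) ∘ M`; inverse matrices
  give inverse substitutions.
* §D **`birthTidy : BirthTidy`** — a non-zero ternary form of degree `d` with `2d < 3μ` cannot vanish to order `μ` at three
  linearly independent vectors: in the frame `b` the form `G = F ∘ M` is a non-zero degree-`d` form vanishing to order `μ` at
  `e₀, e₁, e₂`; the exponent lemma gives `μ + s_t ≤ d` for `t = 0, 1, 2` on any monomial `U^s` of `G`; summing, `3μ + d ≤ 3d`.
* §E **`birthNear : BirthNear`** — one chart of one point blow-up: `aeval_chart_eq_chartTransform` (the `U_j`-chart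
  substitution `χ_j : U_j ↦ U_j, U_l ↦ U_j U_l` IS the tree's `PointBlowup.chartTransform 0 j`), `translate_aeval_chart`
  (`(c ∘ χ_j)(U + b) = (c ∘ s_b) ∘ χ_j` for the linear SHEAR `s_b : U_l ↦ U_l + b_l U_j`, `b_j = 0`), so
  `χ_j(c ∘ s_b) = c′(U + b)·U_j^{m−i}` has order `≥ 2(m − i)`; `coeff_chartExponent_chartTransform` + `degree_chartExponent` give
  `Σ_{l ≠ j} a_l ≥ 2(m − i) − d` for every monomial `U^a` of the degree-`d` form of `c ∘ s_b`, hence that form vanishes to the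
  said order at `e_j` (`lowOrder_translate_single_of_erase_degree`); `translate_single_aeval_shear` +
  `aeval_unshear_aeval_shear` (the shear is linear, commutes with homogeneous components and conjugates `U ↦ U + e_j` to
  `U ↦ U + b̂`, `b̂ = (b, b_j := 1)`) finish. The hypotheses `∀ n < d, homogeneousComponent n c = 0`, `i < m`, `m − i ≤ d` of
  `BirthNear` are not used by the proof (the chart identity already forces what is needed) — harmless, recorded for idea-1.

References (context of the OURS words only): H. Hauser, Bull. AMS 47 (2010) §F (chart expressions of a point blow-up, the
tree's `chartTransform`); Cossart–Jannsen–Saito 2020 Thm. 3.14 / Lemma 8.1 and Cossart–Piltant 2019 Prop. 2.6 (where near points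
are born) — nothing of them is used.
-/

noncomputable section

set_option linter.dupNamespace false

namespace Summit.ResolutionOfSingularities.ResolutionOfSingularities.Theorems.SigmaMaxModificationsCorridor3.Birth


open MvPolynomial Finset
open Literature.AlgebraicGeometry.Resolution
open Literature.AlgebraicGeometry.Resolution.PointBlowup (translate)
open Literature.AlgebraicGeometry.Resolution.WeightedBlowup
open Literature.AlgebraicGeometry.Hironaka2017.EdgeAlgebra (isHomogeneous_aeval_linear homogeneousComponent_aeval_linear)

/-! ## §A. Low-order vanishing: homogeneous components versus coefficients -/

section LowOrder

variable {σ : Type*} {K : Type*} [CommSemiring K]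

/-- All homogeneous components of degree `< μ` vanish iff all coefficients of degree `< μ` vanish. [folklore] -/
theorem forall_homogeneousComponent_eq_zero_iff (P : MvPolynomial σ K) (μ : ℕ) :
    (∀ n < μ, homogeneousComponent n P = 0) ↔ ∀ β : σ →₀ ℕ, β.degree < μ → coeff β P = 0 := by
  constructor
  · intro h β hβ
    have h1 := congrArg (coeff β) (h β.degree hβ)
    rwa [coeff_homogeneousComponent, if_pos rfl, coeff_zero] at h1
  · intro h n hn
    ext β
    rw [coeff_homogeneousComponent, coeff_zero]
    split_ifs with hβ
    · exact h β (hβ ▸ hn)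
    · rfl

end LowOrder

/-! ## §B. Translations: unfolding `VanishesToOrder`, coefficients of translated forms -/

section Translate

variable {σ : Type*} {K : Type*} [Field K] [Fintype σ] [DecidableEq σ]

omit [Fintype σ] [DecidableEq σ] in
/-- `translate b` is the algebra map `X i ↦ X i + C (b i)`. [folklore] -/
theorem translate_eq_aeval (b : σ → K) (P : MvPolynomial σ K) :
    translate b P = aeval (fun i => (X i + C (b i) : MvPolynomial σ K)) P := rfl

omit [DecidableEq σ] in
/-- Coefficients of `translate (Pi.single t 1) (monomial E a)` on the `t`-erased exponent of a monomial of the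
same degree: only `E = s` contributes. [folklore] -/
theorem coeff_erase_translate_single_monomial [DecidableEq σ] (t : σ) (s E : σ →₀ ℕ) (a : K)
    (hdeg : E.degree = s.degree) (hE : E ≠ s) :
    coeff (s.erase t) (translate (Pi.single t 1) (monomial E a)) = 0 := by
  -- some coordinate `i ≠ t` differs
  have hex : ∃ i, i ≠ t ∧ E i ≠ s i := by
    by_contra hne
    push Not at hne
    apply hE
    have hrest : E.erase t = s.erase t := by
      ext i
      by_cases hit : i = t
      · subst hit; rw [Finsupp.erase_same, Finsupp.erase_same]
      · rw [Finsupp.erase_ne hit, Finsupp.erase_ne hit, hne i hit]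
    have ht : E t = s t := by
      have h1 := Finsupp.erase_add_single t E
      have h2 := Finsupp.erase_add_single t s
      have h3 := congrArg Finsupp.degree h1
      have h4 := congrArg Finsupp.degree h2
      rw [map_add, Finsupp.degree_single] at h3 h4
      rw [hrest] at h3
      omega
    rw [← Finsupp.erase_add_single t E, ← Finsupp.erase_add_single t s, hrest, ht]
  obtain ⟨i, hit, hi⟩ := hex
  rcases Nat.lt_or_gt_of_ne hi with hlt | hgt
  · exact coeff_translate_monomial_eq_zero_of_lt _ E _ a (by rwa [Finsupp.erase_ne hit])
  · exact coeff_translate_monomial_eq_zero_of_apply_eq_zero _ E _ a (by rw [Pi.single_apply, if_neg hit])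
      (by rwa [Finsupp.erase_ne hit])

omit [DecidableEq σ] in
/-- The top term: `coeff (s.erase t) (translate e_t (monomial s a)) = a`. [folklore] -/
theorem coeff_erase_translate_single_monomial_self [DecidableEq σ] (t : σ) (s : σ →₀ ℕ) (a : K) :
    coeff (s.erase t) (translate (Pi.single t 1) (monomial s a)) = a := by
  rw [coeff_translate_monomial]
  have h : ∏ i, (((s i).choose (s.erase t i) : K) * (Pi.single t (1 : K) : σ → K) i ^ (s i - s.erase t i)) = 1 := by
    refine Finset.prod_eq_one fun i _ => ?_
    by_cases hit : i = t
    · subst hit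
      rw [Finsupp.erase_same, Pi.single_eq_same, one_pow, Nat.choose_zero_right, Nat.cast_one, one_mul]
    · rw [Finsupp.erase_ne hit, Pi.single_apply, if_neg hit, Nat.choose_self, Nat.sub_self, pow_zero,
        Nat.cast_one, one_mul]
  rw [h, mul_one]

omit [DecidableEq σ] in
/-- **The exponent lemma.** For a form `G` of degree `d` and `s` in its support, the coefficient of `U^{s − s_t e_t}` in
`G(U + e_t)` is `coeff s G`: the other monomials of `G` have the same degree, hence differ from `s` off `t`. [folklore] -/
theorem coeff_erase_translate_single_of_isHomogeneous [DecidableEq σ] {G : MvPolynomial σ K} {d : ℕ}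
    (hG : G.IsHomogeneous d) (t : σ) {s : σ →₀ ℕ} (hs : s ∈ G.support) :
    coeff (s.erase t) (translate (Pi.single t 1) G) = coeff s G := by
  rw [PointBlowup.translate_eq_sum_support, coeff_sum, Finset.sum_eq_single s]
  · exact coeff_erase_translate_single_monomial_self t s _
  · intro E hE hEs
    have hdE : E.degree = d := by
      rw [Finsupp.degree_eq_weight_one]; exact hG (mem_support_iff.mp hE)
    have hds : s.degree = d := by
      rw [Finsupp.degree_eq_weight_one]; exact hG (mem_support_iff.mp hs)
    exact coeff_erase_translate_single_monomial t s E _ (hdE.trans hds.symm) hEs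
  · intro h; exact absurd hs h

omit [DecidableEq σ] in
/-- **Vanishing to order `μ` at `e_t` bounds the `t`-exponents**: `μ + s_t ≤ d` for every monomial `U^s` of a degree-`d` form `G`
with all coefficients of `G(U + e_t)` of degree `< μ` zero. [folklore] -/
theorem add_apply_le_of_lowOrder_translate_single [DecidableEq σ] {G : MvPolynomial σ K} {d : ℕ}
    (hG : G.IsHomogeneous d) (t : σ) {μ : ℕ}
    (hvan : ∀ β : σ →₀ ℕ, β.degree < μ → coeff β (translate (Pi.single t 1) G) = 0)
    {s : σ →₀ ℕ} (hs : s ∈ G.support) : μ + s t ≤ d := by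
  have hds : s.degree = d := by
    rw [Finsupp.degree_eq_weight_one]; exact hG (mem_support_iff.mp hs)
  have hsplit : (s.erase t).degree + s t = d := by
    have h := congrArg Finsupp.degree (Finsupp.erase_add_single t s)
    rwa [map_add, Finsupp.degree_single, hds] at h
  have hne : coeff (s.erase t) (translate (Pi.single t 1) G) ≠ 0 := by
    rw [coeff_erase_translate_single_of_isHomogeneous hG t hs]; exact mem_support_iff.mp hs
  have hge : μ ≤ (s.erase t).degree := by
    by_contra hlt
    exact hne (hvan _ (not_le.mp hlt))
  omega

end Translate

/-! ## §C. Linear substitutions (matrices) and translations -/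

section Linear

variable {σ : Type*} {K : Type*} [Field K] [Fintype σ] [DecidableEq σ]

omit [DecidableEq σ] in
/-- A linear substitution followed by a translation is a translation followed by the linear substitution:
`(F ∘ M)(U + v) = (F(U + M v)) ∘ M`. [folklore] -/
theorem translate_aeval_toMvPolynomial (M : Matrix σ σ K) (v : σ → K) (F : MvPolynomial σ K) :
    translate v (aeval M.toMvPolynomial F) = aeval M.toMvPolynomial (translate (M.mulVec v) F) := by
  have hfun : (fun i => aeval (fun i => (X i + C (v i) : MvPolynomial σ K)) (M.toMvPolynomial i)) =
      fun i => aeval M.toMvPolynomial (X i + C (M.mulVec v i) : MvPolynomial σ K) := by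
    funext i
    have h1 : aeval (fun i => (X i + C (v i) : MvPolynomial σ K)) (M.toMvPolynomial i) =
        ∑ u, (C (M i u) * X u + C (M i u) * C (v u) : MvPolynomial σ K) := by
      simp only [Matrix.toMvPolynomial, map_sum, aeval_monomial, algebraMap_eq, pow_zero, Finsupp.prod_single_index,
        pow_one, mul_add]
    have h2 : aeval M.toMvPolynomial (X i + C (M.mulVec v i) : MvPolynomial σ K) =
        ∑ u, (C (M i u) * X u + C (M i u) * C (v u) : MvPolynomial σ K) := by
      rw [map_add, aeval_X, algHom_C, algebraMap_eq, Finset.sum_add_distrib]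
      simp only [Matrix.toMvPolynomial, Matrix.mulVec, dotProduct, map_sum, map_mul, C_mul_X_eq_monomial]
    rw [h1, h2]
  rw [translate_eq_aeval, translate_eq_aeval, ← AlgHom.comp_apply, comp_aeval, ← AlgHom.comp_apply, comp_aeval,
    hfun]

/-- Inverse matrices give inverse substitutions. [folklore] -/
theorem aeval_toMvPolynomial_aeval_toMvPolynomial_of_mul_eq_one (M N : Matrix σ σ K) (h : M * N = 1)
    (F : MvPolynomial σ K) : aeval N.toMvPolynomial (aeval M.toMvPolynomial F) = F := by
  rw [← AlgHom.comp_apply, comp_aeval]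
  have hfun : (fun i => aeval N.toMvPolynomial (M.toMvPolynomial i)) = fun i => (X i : MvPolynomial σ K) := by
    funext i
    rw [aeval_eq_bind₁, ← Matrix.toMvPolynomial_mul, h, Matrix.toMvPolynomial_one]
  rw [hfun, aeval_X_left, AlgHom.id_apply]

end Linear

/-! ## §D. `BirthTidy` -/

section Tidy

/-- **`BirthTidy` holds** (every field, every characteristic). In the frame `b` (matrix `M` with `M i t = b t i`, i.e. the
substitution `U_i ↦ Σ_t b_t,i U_t`) the form `G = F ∘ M` is again a non-zero form of degree `d` vanishing to order `μ` at the three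
coordinate vectors; by the exponent lemma every monomial `U^s` of `G` has `μ + s_t ≤ d` for `t = 0, 1, 2`, and summing gives
`3μ + d ≤ 3d`, contradicting `2d < 3μ`. [folklore] -/
theorem birthTidy : BirthTidy := by
  intro k _ F d μ hF hF0 hlt b hb hvan
  classical
  let M : Matrix (Fin 3) (Fin 3) k := Matrix.of fun i t => b t i
  have hcol : M.col = b := rfl
  have hMunit : IsUnit M := Matrix.linearIndependent_cols_iff_isUnit.mp (hcol ▸ hb)
  have hMdet : IsUnit M.det := (Matrix.isUnit_iff_isUnit_det M).mp hMunit
  set G : MvPolynomial (Fin 3) k := aeval M.toMvPolynomial F with hGdef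
  have hG : G.IsHomogeneous d := isHomogeneous_aeval_linear _ (fun j => M.toMvPolynomial_isHomogeneous j) hF
  have hG0 : G ≠ 0 := by
    intro h0
    apply hF0
    rw [← aeval_toMvPolynomial_aeval_toMvPolynomial_of_mul_eq_one M M⁻¹ (Matrix.mul_nonsing_inv M hMdet) F, ← hGdef, h0,
      map_zero]
  -- vanishing to order μ at the coordinate vectors, coefficientwise
  have hGvan : ∀ t : Fin 3, ∀ β : Fin 3 →₀ ℕ, β.degree < μ → coeff β (translate (Pi.single t 1) G) = 0 := by
    intro t
    rw [← forall_homogeneousComponent_eq_zero_iff]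
    intro n hn
    have hMv : M.mulVec (Pi.single t 1) = b t := by rw [Matrix.mulVec_single_one, hcol]
    rw [hGdef, translate_aeval_toMvPolynomial, hMv,
      homogeneousComponent_aeval_linear _ (fun j => M.toMvPolynomial_isHomogeneous j)]
    have h := hvan t n hn
    rw [← translate_eq_aeval] at h
    rw [h, map_zero]
  obtain ⟨s, hs⟩ := exists_coeff_ne_zero hG0
  have hs' : s ∈ G.support := mem_support_iff.mpr hs
  have h0 := add_apply_le_of_lowOrder_translate_single hG 0 (hGvan 0) hs'
  have h1 := add_apply_le_of_lowOrder_translate_single hG 1 (hGvan 1) hs'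
  have h2 := add_apply_le_of_lowOrder_translate_single hG 2 (hGvan 2) hs'
  have hdeg : s 0 + s 1 + s 2 = d := by
    have h : s.degree = d := by rw [Finsupp.degree_eq_weight_one]; exact hG hs
    rwa [Finsupp.degree_eq_sum, Fin.sum_univ_three] at h
  omega

end Tidy

end Summit.ResolutionOfSingularities.ResolutionOfSingularities.Theorems.SigmaMaxModificationsCorridor3.Birth

end
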